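import Summits.QuantumFields.YangMills.Theorems.BalabanUVNodesN15ColouredExactDressingLetters
import HarnessLib

/-!
# N15 = NE2 — Σ-col (L-1): THE (2.156) FLUCTUATION COVARIANCE WITH COLOUR — `C_ι(C_ιᵀ A C_ι)⁻¹C_ιᵀ`, `C_ι = C ⊗ₖ 1_ι`, for a coloured unit-bond form `A = Δ^{(n)} ⊗ₖ 1 + P`:
# objects, consistency with b06's scalar covariance, positivity ((2.153) ⊗ colour), and UNIFORM EXPONENTIAL DECAY by the finite Combes–Thomas engine
# (dag-n15-a g29, programme Σ-col, FILE (L-1); node N15 = NE2; `--supports stmt-QuantumFields-27366 --as helper`, count-neutral; three plumbing `def`s + theorems)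

WHY.  The UNIT layer of NE2 ([B9] Thm 3.15's `C^{(k)}_Λ(U)`, (3.185)–(3.187)) on dag-n15-c's COLOURED carrier is the (2.156) fluctuation covariance of the coloured dressed effective form
`A(U) = Δ^{(n)} ⊗ₖ 1 + exDress a (Δ^{(n)}⊗ₖ1) Z(U)` ((J-c′) `siteC − a·1`): `C_ι (C_ιᵀ A C_ι)⁻¹ C_ιᵀ` with b06's elimination matrix `C = elimT L M` (p.250) tensored with the colour.
U-A `cov2156_rate_torus_add` (the scalar engine, via `B6BondEliminationTorus.subReductions_per`) is tied to LATTICE-POINT indices; the coloured index is not.  This file rebuilds the DECAY half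
on the coloured index from two GENERIC engines already in the tree — V-B `abs_inv_le_of_coercive_decay` (finite Combes–Thomas: coercive + entry decay ⇒ the inverse decays) and (2.153) on
the torus (`lowerOnConstrainedT_of_represents`) — with Kronecker bookkeeping only: this file = objects + letters + positivity; the decay itself is FILE (L-2), the RATE (`T4Cov2156Rate.redCov_rate`,
generic) FILE (L-3).

WHAT.  §1 defs `elimC L M ι := elimT L M ⊗ₖ 1` (`B = C_ιB′` colour by colour), `covC L M ι A := redCov (elimC …) A` (= `C_ι(C_ιᵀAC_ι)⁻¹C_ιᵀ`), `fdist` (the pseudo-metric on coloured free variables);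
`elimC_apply∕_mulVec∕_iso∕_range∕_col∕_row` (← b06 `elimT_iso`, `elimT_range` (`≤ L − 1`), `elimT_col` (`≤ 2`), `elimT_row` (`≤ L^{d+1}`)); ★ `covC_kron_one` (CONSISTENCY: `covC (A₀ ⊗ₖ 1) =
(bondReductionT L M A₀).cov ⊗ₖ 1` — at `P = 0` the coloured covariance is b06's (2.156) covariance colour by colour).  §2 sandwich letters: `abs_sandwichT_le` (`|C_ιᵀAC_ι| ≤ 4c_Ae^{2κ(L−1)}e^{−κ·fdist}`),
`abs_sandwich_le` (`|C_ιXC_ιᵀ| ≤ L^{2(d+1)}c_Xe^{2κ(L−1)}e^{−κ·cdist}`), `fsum_le` (row sums on the free variables).  §3 ★ `coercive_sandwichC` ((2.153) ⊗ colour: `C_ιᵀ(Δ^{(n)}⊗1 + P)C_ι` is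
`(γ′₀ − ζV)`-coercive, `γ′₀ = gamma2153 (d+1) L`, for `|P| ≤ ζe^{−δcdist}` with row sums `V`), `isUnit_sandwichC`.
Honest label: finite-dimensional linear algebra + bookkeeping over landed rows ((2.153) on the torus, the (1.66) decay, Combes–Thomas); NO layer of NE2 proved here; no count.
[cite: Balaban1984PropagatorsII, (2.152)–(2.157) pp.249–250 (objects, positivity); Balaban1985BackgroundPropagators, Thm 3.15 (3.185)–(3.187) p.432 (shape of `C^{(k)}(U)`); CombesThomas1973, §II (mechanism)]
-/

noncomputable section

open scoped BigOperators Matrix Kronecker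

namespace Summit.QuantumFields.YangMills.BalabanUVNodes.N15.UnitLayerBgCol

open Literature.MathematicalPhysics.QuantumFieldTheory.Balaban1983to89
open Literature.MathematicalPhysics.QuantumFieldTheory.King1986 (exp_decay_mono)
open Literature.MathematicalPhysics.QuantumFieldTheory.Balaban1983to89.B5Prop11Plancherel (Tor fine)
open Literature.MathematicalPhysics.QuantumFieldTheory.Balaban1983to89.B6Lemma24Torus (pbox)
open Literature.MathematicalPhysics.QuantumFieldTheory.Balaban1983to89.B6Cov2156Torus (freeT elimT deltaPol bondReductionT bondReductionT_cov one_le_M represents_deltaPol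
  lowerOnConstrainedT_of_represents gamma2153 gamma2153_pos elimT_iso elimT_range elimT_col elimT_row q1_elimT_mulVec elimT_mulVec_tree)
open Literature.MathematicalPhysics.QuantumFieldTheory.Balaban1983to89.T4Cov2156Rate (redCov)
open Literature.MathematicalPhysics.QuantumFieldTheory.Balaban1983to89.B4Sect5Proof (latticeConst latticeConst_nonneg)
open Literature.MathematicalPhysics.QuantumFieldTheory.Balaban1983to89.QGQInverse (Coercive isUnit_of_coercive form_abs_le_of_schur)
open Summit.QuantumFields.YangMills.BalabanUVNodes.N15.UnitLayerBg (abs_inv_le_of_coercive_decay rowSum_abs_le colSum_abs_le rowSum_mono entry_mono)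

variable {d : ℕ} (L : ℕ) (M : Fin (d + 1) → ℕ) [∀ μ, NeZero (M μ)] (ι : Type) [Fintype ι] [DecidableEq ι]

/-! ## §1 The coloured elimination, the coloured (2.156) covariance, consistency -/

section Objects

/-- **b06's ELIMINATION MATRIX TENSORED WITH THE COLOUR**: `C_ι := C ⊗ₖ 1_ι` — the substitution `B = CB′` of (2.152)∕(2.156) (δ(QB) with the torus average, δ_{Ax} on the blocks,
p.250's explicit `C = elimT L M`) applied to every colour component of a 𝔤-valued bond field. [cite: Balaban1984PropagatorsII, (2.152)–(2.156) pp.249–250 (object)] -/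
def elimC : Matrix (B4.Idx (pbox M) (d + 1) × ι) (freeT L M × ι) ℝ := elimT L M ⊗ₖ (1 : Matrix ι ι ℝ)

/-- **THE (2.156) FLUCTUATION COVARIANCE WITH COLOUR**: `covC A := C_ι (C_ιᵀ A C_ι)⁻¹ C_ιᵀ` (`T4Cov2156Rate.redCov`) of a coloured unit-bond form `A`.
[cite: Balaban1984PropagatorsII, (2.156) p.250 (object); Balaban1985BackgroundPropagators, (3.185)–(3.187) p.432 (shape of `C^{(k)}(U)`)] -/
def covC (A : Matrix (B4.Idx (pbox M) (d + 1) × ι) (B4.Idx (pbox M) (d + 1) × ι) ℝ) : Matrix (B4.Idx (pbox M) (d + 1) × ι) (B4.Idx (pbox M) (d + 1) × ι) ℝ :=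
  redCov (elimC L M ι) A

/-- THE PSEUDO-METRIC ON THE COLOURED FREE VARIABLES: `cdist` of the underlying coloured bonds. [folklore] -/
def fdist (g g' : freeT L M × ι) : ℝ := cdist M ι ((g.1 : B4.Idx (pbox M) (d + 1)), g.2) ((g'.1 : B4.Idx (pbox M) (d + 1)), g'.2)

variable {L M ι}

omit [∀ μ, NeZero (M μ)] [Fintype ι] in
/-- entries of `C ⊗ₖ 1`. [folklore] -/
theorem elimC_apply (p : B4.Idx (pbox M) (d + 1) × ι) (g : freeT L M × ι) : elimC L M ι p g = if p.2 = g.2 then elimT L M p.1 g.1 else 0 := by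
  rw [elimC, Matrix.kroneckerMap_apply, Matrix.one_apply, mul_ite, mul_one, mul_zero]

omit [∀ μ, NeZero (M μ)] in
/-- `(C ⊗ₖ 1) *ᵥ x` acts colour by colour. [folklore] -/
theorem elimC_mulVec (x : freeT L M × ι → ℝ) (p : B4.Idx (pbox M) (d + 1) × ι) :
    (elimC L M ι *ᵥ x) p = (elimT L M *ᵥ fun f => x (f, p.2)) p.1 := by
  rw [Matrix.mulVec, Matrix.mulVec, dotProduct, dotProduct, Fintype.sum_prod_type]
  refine Finset.sum_congr rfl fun f _ => ?_
  rw [Finset.sum_eq_single p.2]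
  · rw [elimC_apply, if_pos rfl]
  · intro j _ hj; rw [elimC_apply, if_neg (Ne.symm hj), zero_mul]
  · intro h; exact absurd (Finset.mem_univ _) h

/-- a quadratic form of a colour lift splits colour by colour: `y ⬝ ((Δ ⊗ₖ 1) y) = Σ_i y(·,i) ⬝ (Δ y(·,i))`. [folklore] -/
theorem dot_kron_one_mulVec {X : Type} [Fintype X] (Δ : Matrix X X ℝ) (y : X × ι → ℝ) :
    y ⬝ᵥ ((Δ ⊗ₖ (1 : Matrix ι ι ℝ)) *ᵥ y) = ∑ i : ι, (fun a => y (a, i)) ⬝ᵥ (Δ *ᵥ fun a => y (a, i)) := by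
  rw [dotProduct, Fintype.sum_prod_type, Finset.sum_comm]
  refine Finset.sum_congr rfl fun i _ => ?_
  rw [dotProduct]
  refine Finset.sum_congr rfl fun a _ => ?_
  rw [kron_one_mulVec]

omit [DecidableEq ι] in
/-- the Euclidean norm splits colour by colour. [folklore] -/
theorem dot_self_eq_sum_colour {X : Type} [Fintype X] (y : X × ι → ℝ) : y ⬝ᵥ y = ∑ i : ι, (fun a => y (a, i)) ⬝ᵥ fun a => y (a, i) := by
  rw [dotProduct, Fintype.sum_prod_type, Finset.sum_comm]
  exact Finset.sum_congr rfl fun i _ => rfl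

omit [∀ μ, NeZero (M μ)] in
/-- ★ `‖x‖² ≤ ‖C_ι x‖²` (b06 `elimT_iso` colour by colour: a free variable is copied). [cite: Balaban1984PropagatorsII, p.250] -/
theorem elimC_iso (x : freeT L M × ι → ℝ) : x ⬝ᵥ x ≤ (elimC L M ι *ᵥ x) ⬝ᵥ (elimC L M ι *ᵥ x) := by
  rw [dot_self_eq_sum_colour x, dot_self_eq_sum_colour (elimC L M ι *ᵥ x)]
  refine Finset.sum_le_sum fun i _ => ?_
  have h := elimT_iso (L := L) (M := M) (fun f => x (f, i))
  have e1 : (fun f => x (f, i)) ⬝ᵥ (fun f => x (f, i)) = ∑ f, x (f, i) ^ 2 := by simp only [dotProduct, pow_two]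
  have e2 : (fun a => (elimC L M ι *ᵥ x) (a, i)) ⬝ᵥ (fun a => (elimC L M ι *ᵥ x) (a, i)) = ∑ p, (elimT L M *ᵥ fun f => x (f, i)) p ^ 2 := by
    simp only [dotProduct, pow_two, elimC_mulVec]
  rw [e1, e2]; exact h

omit [∀ μ, NeZero (M μ)] [Fintype ι] in
/-- a nonzero entry of `C ⊗ₖ 1` keeps the colour and is one of `C`. [folklore] -/
theorem elimC_ne_zero {p : B4.Idx (pbox M) (d + 1) × ι} {g : freeT L M × ι} (h : elimC L M ι p g ≠ 0) : p.2 = g.2 ∧ elimT L M p.1 g.1 ≠ 0 := by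
  rw [elimC_apply] at h
  by_cases hc : p.2 = g.2
  · rw [if_pos hc] at h; exact ⟨hc, h⟩
  · rw [if_neg hc] at h; exact absurd rfl h

omit [Fintype ι] in
/-- ★ RANGE of `C ⊗ₖ 1`: a nonzero entry links bonds at periodic distance `≤ L − 1` (b06 `elimT_range`, p.250 «C is a short-ranged operator»). [cite: Balaban1984PropagatorsII, p.250] -/
theorem elimC_range (hL : 0 < L) {p : B4.Idx (pbox M) (d + 1) × ι} {g : freeT L M × ι} (h : elimC L M ι p g ≠ 0) :
    cdist M ι p ((g.1 : B4.Idx (pbox M) (d + 1)), g.2) ≤ (L : ℝ) - 1 := by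
  rw [cdist_eq]
  exact elimT_range hL p.1 g.1 (elimC_ne_zero h).2

omit [∀ μ, NeZero (M μ)] in
/-- COLUMN SUMS of `C ⊗ₖ 1`: `Σ_p |C_ι(p,g)| ≤ 2` (b06 `elimT_col`). [cite: Balaban1984PropagatorsII, p.250] -/
theorem elimC_col (hL : 0 < L) (hLM : ∀ μ, L ∣ M μ) (g : freeT L M × ι) : ∑ p, |elimC L M ι p g| ≤ 2 := by
  rw [Fintype.sum_prod_type]
  calc ∑ a, ∑ j, |elimC L M ι (a, j) g| = ∑ a, |elimT L M a g.1| := Finset.sum_congr rfl fun a _ => by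
          rw [Finset.sum_eq_single g.2]
          · rw [elimC_apply, if_pos rfl]
          · intro j _ hj; rw [elimC_apply, if_neg hj, abs_zero]
          · intro h; exact absurd (Finset.mem_univ _) h
    _ ≤ 2 := elimT_col hL hLM g.1

omit [∀ μ, NeZero (M μ)] in
/-- ROW SUMS of `C ⊗ₖ 1`: `Σ_g |C_ι(p,g)| ≤ L^{d+1}` (b06 `elimT_row`). [cite: Balaban1984PropagatorsII, p.250] -/
theorem elimC_row (hL : 0 < L) (p : B4.Idx (pbox M) (d + 1) × ι) : ∑ g, |elimC L M ι p g| ≤ (L : ℝ) ^ (d + 1) := by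
  rw [Fintype.sum_prod_type]
  calc ∑ f, ∑ j, |elimC L M ι p (f, j)| = ∑ f, |elimT L M p.1 f| := Finset.sum_congr rfl fun f _ => by
          rw [Finset.sum_eq_single p.2]
          · rw [elimC_apply, if_pos rfl]
          · intro j _ hj; rw [elimC_apply, if_neg (Ne.symm hj), abs_zero]
          · intro h; exact absurd (Finset.mem_univ _) h
    _ ≤ (L : ℝ) ^ (d + 1) := elimT_row hL p.1

omit [∀ μ, NeZero (M μ)] in
/-- `C_ιᵀ (A₀ ⊗ₖ 1) C_ι = (Cᵀ A₀ C) ⊗ₖ 1`. [folklore] -/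
theorem transpose_elimC_mul_kron_mul (A₀ : Matrix (B4.Idx (pbox M) (d + 1)) (B4.Idx (pbox M) (d + 1)) ℝ) :
    (elimC L M ι)ᵀ * (A₀ ⊗ₖ (1 : Matrix ι ι ℝ)) * elimC L M ι = ((elimT L M)ᵀ * A₀ * elimT L M) ⊗ₖ (1 : Matrix ι ι ℝ) := by
  rw [elimC, ← Matrix.kroneckerMap_transpose, Matrix.transpose_one, ← Matrix.mul_kronecker_mul, ← Matrix.mul_kronecker_mul, Matrix.one_mul, Matrix.one_mul]

omit [∀ μ, NeZero (M μ)] in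
/-- `C_ι (X ⊗ₖ 1) C_ιᵀ = (C X Cᵀ) ⊗ₖ 1`. [folklore] -/
theorem elimC_mul_kron_mul_transpose (X : Matrix (freeT L M) (freeT L M) ℝ) :
    elimC L M ι * (X ⊗ₖ (1 : Matrix ι ι ℝ)) * (elimC L M ι)ᵀ = (elimT L M * X * (elimT L M)ᵀ) ⊗ₖ (1 : Matrix ι ι ℝ) := by
  rw [elimC, ← Matrix.kroneckerMap_transpose, Matrix.transpose_one, ← Matrix.mul_kronecker_mul, ← Matrix.mul_kronecker_mul, Matrix.one_mul, Matrix.one_mul]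

omit [∀ μ, NeZero (M μ)] in
/-- ★ **CONSISTENCY — AT A COLOUR-DIAGONAL FORM THE COLOURED COVARIANCE IS b06's (2.156) COVARIANCE COLOUR BY COLOUR**: `C_ιᵀA₀C_ι` invertible ⟹
`covC (A₀ ⊗ₖ 1) = (bondReductionT L M A₀).cov ⊗ₖ 1` — in particular at `P = 0` the unit layer built on `covC` IS part 76's ∕ S-D's genuine (2.156) kernel ⊗ colour.
[cite: Balaban1984PropagatorsII, (2.156) p.250] -/
theorem covC_kron_one {A₀ : Matrix (B4.Idx (pbox M) (d + 1)) (B4.Idx (pbox M) (d + 1)) ℝ} (hS : IsUnit ((elimT L M)ᵀ * A₀ * elimT L M).det) :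
    covC L M ι (A₀ ⊗ₖ (1 : Matrix ι ι ℝ)) = (bondReductionT L M A₀).cov ⊗ₖ (1 : Matrix ι ι ℝ) := by
  have h1 : covC L M ι (A₀ ⊗ₖ (1 : Matrix ι ι ℝ)) = elimC L M ι * (((elimT L M)ᵀ * A₀ * elimT L M)⁻¹ ⊗ₖ (1 : Matrix ι ι ℝ)) * (elimC L M ι)ᵀ := by
    rw [covC, redCov, transpose_elimC_mul_kron_mul, kron_one_inv_eq ι (Matrix.mul_nonsing_inv _ hS)]
  rw [h1, elimC_mul_kron_mul_transpose, bondReductionT_cov]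
  congr!

end Objects

/-! ## §2 Sandwich letters: locality of `C ⊗ₖ 1` moves exponential decay through `C_ιᵀ·C_ι` and `C_ι·C_ιᵀ` -/

section Sandwich

variable {L M ι}

omit [Fintype ι] [DecidableEq ι] in
/-- `fdist` is `cdist` of the underlying bonds (unfolding). [folklore] -/
theorem fdist_eq (g g' : freeT L M × ι) : fdist L M ι g g' = cdist M ι ((g.1 : B4.Idx (pbox M) (d + 1)), g.2) ((g'.1 : B4.Idx (pbox M) (d + 1)), g'.2) := rfl

omit [DecidableEq ι] in
/-- ROW SUMS ON THE COLOURED FREE VARIABLES: `Σ_{g′} e^{−a·fdist(g,g′)} ≤ |ι|·(d+1)·K_{d+1}(a)` (a sub-sum of (G) `colSum_le`). [cite: Balaban1984PropagatorsII, Lemma 2.1 (2.61) p.234 (lattice sums)] -/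
theorem fsum_le {a : ℝ} (ha : 0 < a) (g : freeT L M × ι) :
    ∑ g' : freeT L M × ι, Real.exp (-(a * fdist L M ι g g')) ≤ Fintype.card ι * (((d : ℝ) + 1) * latticeConst (d + 1) a) := by
  have hsub : ∑ g' : freeT L M × ι, Real.exp (-(a * fdist L M ι g g')) ≤
      ∑ q : B4.Idx (pbox M) (d + 1) × ι, Real.exp (-(a * cdist M ι ((g.1 : B4.Idx (pbox M) (d + 1)), g.2) q)) := by
    rw [Fintype.sum_prod_type, Fintype.sum_prod_type]
    have h1 : ∑ f : freeT L M, ∑ j : ι, Real.exp (-(a * fdist L M ι g (f, j))) =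
        ∑ b ∈ freeT L M, ∑ j : ι, Real.exp (-(a * cdist M ι ((g.1 : B4.Idx (pbox M) (d + 1)), g.2) (b, j))) :=
      Finset.sum_coe_sort (freeT L M) (fun b => ∑ j : ι, Real.exp (-(a * cdist M ι ((g.1 : B4.Idx (pbox M) (d + 1)), g.2) (b, j))))
    rw [h1]
    exact Finset.sum_le_univ_sum_of_nonneg fun b => Finset.sum_nonneg fun j _ => (Real.exp_pos _).le
  exact hsub.trans (colSum_le M ι ha _)

/-- ★ **`|C_ιᵀ A C_ι (g,g′)| ≤ 4·c_A·e^{2κ(L−1)}·e^{−κ·fdist(g,g′)}`** for `|A(p,q)| ≤ c_A e^{−κ·cdist}` (`κ ≥ 0`; column sums `≤ 2`, range `≤ L − 1`). [cite: Balaban1984PropagatorsII, p.250 («C*Δ_kC has the same exponential decay as Δ_k»)] -/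
theorem abs_sandwichT_le (hL : 0 < L) (hLM : ∀ μ, L ∣ M μ) {A : Matrix (B4.Idx (pbox M) (d + 1) × ι) (B4.Idx (pbox M) (d + 1) × ι) ℝ} {cA κ : ℝ} (hcA : 0 ≤ cA) (hκ : 0 ≤ κ)
    (hA : ∀ p q, |A p q| ≤ cA * Real.exp (-(κ * cdist M ι p q))) (g g' : freeT L M × ι) :
    |((elimC L M ι)ᵀ * A * elimC L M ι) g g'| ≤ 4 * cA * Real.exp (2 * κ * ((L : ℝ) - 1)) * Real.exp (-(κ * fdist L M ι g g')) := by
  set pg : B4.Idx (pbox M) (d + 1) × ι := ((g.1 : B4.Idx (pbox M) (d + 1)), g.2) with hpg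
  set pg' : B4.Idx (pbox M) (d + 1) × ι := ((g'.1 : B4.Idx (pbox M) (d + 1)), g'.2) with hpg'
  have hE : Real.exp (-(κ * fdist L M ι g g')) = Real.exp (-(κ * cdist M ι pg pg')) := rfl
  -- each term: |C p g| |A p q| |C q g'| ≤ |C p g| |C q g'| cA e^{2κ(L−1)} e^{−κ fdist}
  have hterm : ∀ p q, |elimC L M ι p g * A p q * elimC L M ι q g'| ≤
      |elimC L M ι p g| * |elimC L M ι q g'| * (cA * Real.exp (2 * κ * ((L : ℝ) - 1)) * Real.exp (-(κ * cdist M ι pg pg'))) := by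
    intro p q
    rw [abs_mul, abs_mul]
    by_cases hp : elimC L M ι p g = 0
    · simp [hp]
    by_cases hq : elimC L M ι q g' = 0
    · simp [hq]
    have hrp : cdist M ι p pg ≤ (L : ℝ) - 1 := elimC_range hL hp
    have hrq : cdist M ι q pg' ≤ (L : ℝ) - 1 := elimC_range hL hq
    have htri : cdist M ι pg pg' ≤ cdist M ι p q + 2 * ((L : ℝ) - 1) := by
      have h1 := cdist_triangle M ι pg p pg'
      have h2 := cdist_triangle M ι p q pg'
      rw [cdist_comm M ι pg p] at h1
      linarith
    have hexp : Real.exp (-(κ * cdist M ι p q)) ≤ Real.exp (2 * κ * ((L : ℝ) - 1)) * Real.exp (-(κ * cdist M ι pg pg')) := by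
      rw [← Real.exp_add]; exact Real.exp_le_exp.mpr (by nlinarith)
    calc |elimC L M ι p g| * |A p q| * |elimC L M ι q g'| ≤ |elimC L M ι p g| * (cA * Real.exp (-(κ * cdist M ι p q))) * |elimC L M ι q g'| :=
          mul_le_mul_of_nonneg_right (mul_le_mul_of_nonneg_left (hA p q) (abs_nonneg _)) (abs_nonneg _)
      _ ≤ |elimC L M ι p g| * (cA * (Real.exp (2 * κ * ((L : ℝ) - 1)) * Real.exp (-(κ * cdist M ι pg pg')))) * |elimC L M ι q g'| :=
          mul_le_mul_of_nonneg_right (mul_le_mul_of_nonneg_left (mul_le_mul_of_nonneg_left hexp hcA) (abs_nonneg _)) (abs_nonneg _)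
      _ = _ := by ring
  have hcol := elimC_col (ι := ι) hL hLM g
  have hcol' := elimC_col (ι := ι) hL hLM g'
  rw [Matrix.mul_apply, hE]
  calc |∑ q, ((elimC L M ι)ᵀ * A) g q * elimC L M ι q g'|
      ≤ ∑ q, |((elimC L M ι)ᵀ * A) g q * elimC L M ι q g'| := Finset.abs_sum_le_sum_abs _ _
    _ ≤ ∑ q, ∑ p, |elimC L M ι p g| * |elimC L M ι q g'| * (cA * Real.exp (2 * κ * ((L : ℝ) - 1)) * Real.exp (-(κ * cdist M ι pg pg'))) := by
        refine Finset.sum_le_sum fun q _ => ?_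
        rw [Matrix.mul_apply, Finset.sum_mul]
        refine (Finset.abs_sum_le_sum_abs _ _).trans (Finset.sum_le_sum fun p _ => ?_)
        rw [Matrix.transpose_apply]
        exact hterm p q
    _ = (∑ p, |elimC L M ι p g|) * (∑ q, |elimC L M ι q g'|) * (cA * Real.exp (2 * κ * ((L : ℝ) - 1)) * Real.exp (-(κ * cdist M ι pg pg'))) := by
        rw [Finset.sum_comm, Finset.sum_mul, Finset.sum_mul]
        refine Finset.sum_congr rfl fun p _ => ?_
        rw [Finset.mul_sum, Finset.sum_mul]
    _ ≤ 2 * 2 * (cA * Real.exp (2 * κ * ((L : ℝ) - 1)) * Real.exp (-(κ * cdist M ι pg pg'))) := by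
        have h0 : 0 ≤ cA * Real.exp (2 * κ * ((L : ℝ) - 1)) * Real.exp (-(κ * cdist M ι pg pg')) := by positivity
        exact mul_le_mul_of_nonneg_right (mul_le_mul hcol hcol' (Finset.sum_nonneg fun _ _ => abs_nonneg _) zero_le_two) h0
    _ = _ := by ring

/-- ★ **`|C_ι X C_ιᵀ (p,q)| ≤ L^{2(d+1)}·c_X·e^{2κ(L−1)}·e^{−κ·cdist(p,q)}`** for `|X(g,g′)| ≤ c_X e^{−κ·fdist}` (`κ ≥ 0`; row sums `≤ L^{d+1}`, range `≤ L − 1`). [cite: Balaban1984PropagatorsII, p.250] -/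
theorem abs_sandwich_le (hL : 0 < L) {X : Matrix (freeT L M × ι) (freeT L M × ι) ℝ} {cX κ : ℝ} (hcX : 0 ≤ cX) (hκ : 0 ≤ κ)
    (hX : ∀ g g', |X g g'| ≤ cX * Real.exp (-(κ * fdist L M ι g g'))) (p q : B4.Idx (pbox M) (d + 1) × ι) :
    |(elimC L M ι * X * (elimC L M ι)ᵀ) p q| ≤ ((L : ℝ) ^ (d + 1)) ^ 2 * cX * Real.exp (2 * κ * ((L : ℝ) - 1)) * Real.exp (-(κ * cdist M ι p q)) := by
  have hterm : ∀ g g', |elimC L M ι p g * X g g' * elimC L M ι q g'| ≤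
      |elimC L M ι p g| * |elimC L M ι q g'| * (cX * Real.exp (2 * κ * ((L : ℝ) - 1)) * Real.exp (-(κ * cdist M ι p q))) := by
    intro g g'
    rw [abs_mul, abs_mul]
    by_cases hp : elimC L M ι p g = 0
    · simp [hp]
    by_cases hq : elimC L M ι q g' = 0
    · simp [hq]
    have hrp := elimC_range hL hp
    have hrq := elimC_range hL hq
    have htri : cdist M ι p q ≤ fdist L M ι g g' + 2 * ((L : ℝ) - 1) := by
      rw [fdist_eq]
      have h1 := cdist_triangle M ι p ((g.1 : B4.Idx (pbox M) (d + 1)), g.2) q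
      have h2 := cdist_triangle M ι ((g.1 : B4.Idx (pbox M) (d + 1)), g.2) ((g'.1 : B4.Idx (pbox M) (d + 1)), g'.2) q
      rw [cdist_comm M ι q] at hrq
      have h3 := cdist_comm M ι ((g'.1 : B4.Idx (pbox M) (d + 1)), g'.2) q
      linarith
    have hexp : Real.exp (-(κ * fdist L M ι g g')) ≤ Real.exp (2 * κ * ((L : ℝ) - 1)) * Real.exp (-(κ * cdist M ι p q)) := by
      rw [← Real.exp_add]; exact Real.exp_le_exp.mpr (by nlinarith)
    calc |elimC L M ι p g| * |X g g'| * |elimC L M ι q g'| ≤ |elimC L M ι p g| * (cX * Real.exp (-(κ * fdist L M ι g g'))) * |elimC L M ι q g'| :=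
          mul_le_mul_of_nonneg_right (mul_le_mul_of_nonneg_left (hX g g') (abs_nonneg _)) (abs_nonneg _)
      _ ≤ |elimC L M ι p g| * (cX * (Real.exp (2 * κ * ((L : ℝ) - 1)) * Real.exp (-(κ * cdist M ι p q)))) * |elimC L M ι q g'| :=
          mul_le_mul_of_nonneg_right (mul_le_mul_of_nonneg_left (mul_le_mul_of_nonneg_left hexp hcX) (abs_nonneg _)) (abs_nonneg _)
      _ = _ := by ring
  have hrow := elimC_row (ι := ι) (M := M) hL p
  have hrow' := elimC_row (ι := ι) (M := M) hL q
  have hLd : (0 : ℝ) ≤ (L : ℝ) ^ (d + 1) := by positivity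
  rw [Matrix.mul_apply]
  calc |∑ g', (elimC L M ι * X) p g' * (elimC L M ι)ᵀ g' q|
      ≤ ∑ g', |(elimC L M ι * X) p g' * (elimC L M ι)ᵀ g' q| := Finset.abs_sum_le_sum_abs _ _
    _ ≤ ∑ g', ∑ g, |elimC L M ι p g| * |elimC L M ι q g'| * (cX * Real.exp (2 * κ * ((L : ℝ) - 1)) * Real.exp (-(κ * cdist M ι p q))) := by
        refine Finset.sum_le_sum fun g' _ => ?_
        rw [Matrix.mul_apply, Finset.sum_mul, Matrix.transpose_apply]
        refine (Finset.abs_sum_le_sum_abs _ _).trans (Finset.sum_le_sum fun g _ => hterm g g')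
    _ = (∑ g, |elimC L M ι p g|) * (∑ g', |elimC L M ι q g'|) * (cX * Real.exp (2 * κ * ((L : ℝ) - 1)) * Real.exp (-(κ * cdist M ι p q))) := by
        rw [Finset.sum_comm, Finset.sum_mul, Finset.sum_mul]
        refine Finset.sum_congr rfl fun g _ => ?_
        rw [Finset.mul_sum, Finset.sum_mul]
    _ ≤ (L : ℝ) ^ (d + 1) * (L : ℝ) ^ (d + 1) * (cX * Real.exp (2 * κ * ((L : ℝ) - 1)) * Real.exp (-(κ * cdist M ι p q))) := by
        have h0 : 0 ≤ cX * Real.exp (2 * κ * ((L : ℝ) - 1)) * Real.exp (-(κ * cdist M ι p q)) := by positivity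
        exact mul_le_mul_of_nonneg_right (mul_le_mul hrow hrow' (Finset.sum_nonneg fun _ _ => abs_nonneg _) hLd) h0
    _ = _ := by ring

end Sandwich

/-! ## §3 Positivity: (2.153) ⊗ colour — the coloured sandwich is coercive, perturbations cost `ζV` -/

section Positivity

variable {L M ι}

/-- ★ **(2.153) ⊗ COLOUR + A DECAYING PERTURBATION**: for `d ≥ 1`, `L ≥ 1`, `L ∣ M`, `n ≥ 1` and a coloured perturbation `|P(p,q)| ≤ ζe^{−δ·cdist}` with row sums `Σ_q e^{−δ cdist} ≤ V`,
`ζV ≤ γ′₀ = gamma2153 (d+1) L`:  `C_ιᵀ (Δ^{(n)} ⊗ₖ 1 + P) C_ι` is `(γ′₀ − ζV)`-coercive on the coloured free variables — (2.153) on the torus colour by colour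
(`lowerOnConstrainedT_of_represents`; constraints of `C_ιx` by `q1_elimT_mulVec`, `elimT_mulVec_tree`), `‖x‖ ≤ ‖C_ιx‖` (`elimC_iso`), the finite Schur test for `P`.
[cite: Balaban1984PropagatorsII, (2.153) p.249, (2.157) p.250] -/
theorem coercive_sandwichC (hd : 1 ≤ d) (hL : 1 ≤ L) (hLM : ∀ μ, L ∣ M μ) {n : ℕ} (hn : 1 ≤ n)
    {P : Matrix (B4.Idx (pbox M) (d + 1) × ι) (B4.Idx (pbox M) (d + 1) × ι) ℝ} {ζ δ V : ℝ} (hζ : 0 ≤ ζ) (hV0 : 0 ≤ V)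
    (hP : ∀ p q, |P p q| ≤ ζ * Real.exp (-(δ * cdist M ι p q))) (hV : ∀ p, ∑ q, Real.exp (-(δ * cdist M ι p q)) ≤ V) (hζV : ζ * V ≤ gamma2153 (d + 1) L) :
    Coercive ((elimC L M ι)ᵀ * (deltaPol M n ⊗ₖ (1 : Matrix ι ι ℝ) + P) * elimC L M ι) (gamma2153 (d + 1) L - ζ * V) := by
  have hL0 : 0 < L := hL
  have hl := lowerOnConstrainedT_of_represents M (by omega) hL n hn hLM (represents_deltaPol M n)
  intro x
  set y := elimC L M ι *ᵥ x with hy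
  -- `x ⬝ W x = y ⬝ (Δ⊗1 + P) y`
  have hform : x ⬝ᵥ (((elimC L M ι)ᵀ * (deltaPol M n ⊗ₖ (1 : Matrix ι ι ℝ) + P) * elimC L M ι) *ᵥ x) =
      y ⬝ᵥ ((deltaPol M n ⊗ₖ (1 : Matrix ι ι ℝ)) *ᵥ y) + y ⬝ᵥ (P *ᵥ y) := by
    rw [← Matrix.mulVec_mulVec, ← Matrix.mulVec_mulVec, Matrix.dotProduct_mulVec, Matrix.vecMul_transpose, ← hy, Matrix.add_mulVec, dotProduct_add]
  -- (2.153) colour by colour: `y ⬝ (Δ⊗1) y ≥ γ′₀ ‖y‖²`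
  have hΔ : gamma2153 (d + 1) L * (y ⬝ᵥ y) ≤ y ⬝ᵥ ((deltaPol M n ⊗ₖ (1 : Matrix ι ι ℝ)) *ᵥ y) := by
    rw [dot_kron_one_mulVec, dot_self_eq_sum_colour y, Finset.mul_sum]
    refine Finset.sum_le_sum fun i _ => ?_
    have hyi : (fun a => y (a, i)) = elimT L M *ᵥ fun f => x (f, i) := funext fun a => by rw [hy, elimC_mulVec]
    rw [hyi]
    have h := hl (elimT L M *ᵥ fun f => x (f, i)) (fun c hc => q1_elimT_mulVec hL0 hLM _ hc) (fun p hp => elimT_mulVec_tree _ hp)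
    have e1 : (elimT L M *ᵥ fun f => x (f, i)) ⬝ᵥ (elimT L M *ᵥ fun f => x (f, i)) = ∑ p, (elimT L M *ᵥ fun f => x (f, i)) p ^ 2 := by
      simp only [dotProduct, pow_two]
    have e2 : (elimT L M *ᵥ fun f => x (f, i)) ⬝ᵥ (deltaPol M n *ᵥ (elimT L M *ᵥ fun f => x (f, i))) =
        ∑ p, (elimT L M *ᵥ fun f => x (f, i)) p * (deltaPol M n *ᵥ (elimT L M *ᵥ fun f => x (f, i))) p := rfl
    rw [e1, e2]; exact h
  -- the perturbation: `|y ⬝ P y| ≤ ζV ‖y‖²`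
  have hPf : |y ⬝ᵥ (P *ᵥ y)| ≤ ζ * V * (y ⬝ᵥ y) :=
    form_abs_le_of_schur P (ρ := ζ * V) (mul_nonneg hζ hV0) (le_of_eq (pow_two _).symm)
      (rowSum_abs_le (cdist M ι) hζ hP hV) (colSum_abs_le (cdist M ι) (cdist_comm M ι) hζ hP hV) y
  have hPl : -(ζ * V * (y ⬝ᵥ y)) ≤ y ⬝ᵥ (P *ᵥ y) := by have := neg_abs_le (y ⬝ᵥ (P *ᵥ y)); linarith
  -- `‖x‖² ≤ ‖y‖²`
  have hiso : x ⬝ᵥ x ≤ y ⬝ᵥ y := elimC_iso x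
  have hγ0 : 0 ≤ gamma2153 (d + 1) L - ζ * V := by linarith
  rw [hform]
  nlinarith [mul_le_mul_of_nonneg_left hiso hγ0]

/-- **(2.157) WITH COLOUR — `C_ιᵀ(Δ^{(n)}⊗1 + P)C_ι` IS INVERTIBLE** below the threshold `ζV < γ′₀`. [cite: Balaban1984PropagatorsII, (2.157) p.250 (shape)] -/
theorem isUnit_sandwichC (hd : 1 ≤ d) (hL : 1 ≤ L) (hLM : ∀ μ, L ∣ M μ) {n : ℕ} (hn : 1 ≤ n)
    {P : Matrix (B4.Idx (pbox M) (d + 1) × ι) (B4.Idx (pbox M) (d + 1) × ι) ℝ} {ζ δ V : ℝ} (hζ : 0 ≤ ζ) (hV0 : 0 ≤ V)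
    (hP : ∀ p q, |P p q| ≤ ζ * Real.exp (-(δ * cdist M ι p q))) (hV : ∀ p, ∑ q, Real.exp (-(δ * cdist M ι p q)) ≤ V) (hζV : ζ * V < gamma2153 (d + 1) L) :
    IsUnit ((elimC L M ι)ᵀ * (deltaPol M n ⊗ₖ (1 : Matrix ι ι ℝ) + P) * elimC L M ι).det :=
  (Matrix.isUnit_iff_isUnit_det _).mp (isUnit_of_coercive (by linarith) (coercive_sandwichC hd hL hLM hn hζ hV0 hP hV hζV.le))

end Positivity

end Summit.QuantumFields.YangMills.BalabanUVNodes.N15.UnitLayerBgCol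

end
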